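import Summits.ResolutionOfSingularities.ResolutionOfSingularities.Theorems.EquisingularLiftEquisingularLiftNatNDChartPlays
import Literature.AlgebraicGeometry.Resolution.CoordinateBlowupChart
import HarnessLib

/-!
# [OURS · L1 W4.5(b) · EL♮(3)] ND CHART DICTIONARY (4/5) — `…NatNDChartBlowup`: §12.7 Jacobian form ⟹ `𝔪`-adic order one (`mul_not_mem_ker_sq_of_eval_pderiv(_map)_ne_zero`,
# `end_order_one_of_wonPlay` — the algebraic half of (O4)) and §12.8 ONE LEGAL STAR = ONE COORDINATE BLOW-UP CHART of the tree's `coordBlowupSubst` (Hu 2025 Prop. 5.3):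
# `starChart`, `coordBlowupSubst_chartPull`, `coordBlowupSubst_toricStrict` (exceptional multiplicity `δ`), `bad_iff_sum_hminN_lt` (`δ ≥ 1 ⟺ Bad ⟺ E1`)

OURS · L1 W4.5(b) · EL♮(3) stmt-ResolutionOfSingularities-20148 · counted 0 · AI-written (res-L1-w45b-idea-1 g22; landed in the text owner's lane by res-L1-w45b-lead-2 g6 on
idea-1's OFFER R8-4), weaker than expert review; nothing of [Hironaka2017] asserted; no statement of the manuscript. Sorry-free, axioms standard, no instance, no
notation. `--supports stmt-ResolutionOfSingularities-20148 --as helper`: support module toward the registered 4th CHILD stub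
`stub_elnat_three_isolated_newtonNondegenerate` (`IsoHypNDWon → ELNatConclusionO`, first unproved lemma `nd_rung_local`): this is the PROVED `k`-SIDE of that
rung's toric dictionary; the `O`-side plumbing (O1)–(O5) of `Cruxes/EquisingularLiftNatThree/NewtonNondegenerateRung.lean` §10.3 is untouched.
SOURCE = idea-1's companion `Cruxes/EquisingularLiftNatThree/NewtonNondegenerateRungCharts.lean` v4 sha16 391adf33f7303999 (1049 l., farm rc 0 · 0 sorries; §§12.1–12.6 = 54ad50e211ef87b7), bodies
VERBATIM; tree home = namespace `…Cruxes.EquisingularLiftNat.Sections.ND` (text owner's ruling on R8-4), imports route-independent, prelude lemmas public, split by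
the 400-line rule into `…NatNDChartPullback` (§12.1–§12.2) → `…NatNDChartEnd` (§12.3) → `…NatNDChartPlays` (§12.4–§12.6) → `…NatNDChartBlowup` (§12.7–§12.8) →
`…NatNDChartFrame` (§12.9–§12.10).
-/

noncomputable section

set_option linter.dupNamespace false

open MvPolynomial

namespace Summit.ResolutionOfSingularities.ResolutionOfSingularities.Cruxes.EquisingularLiftNat.Sections.ND

open Summit.ResolutionOfSingularities.ResolutionOfSingularities.Cruxes.EquisingularLiftNat.Sections

variable {k : Type} [Field k] {N : ℕ} {n : ℕ}

/-! ### 12.7 From the Jacobian form to `𝔪`-adic order one — the algebraic half of (O4) (PROVED) -/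

/-- A polynomial in the SQUARE of the ideal of a rational point has all first partials vanishing at that point. -/
theorem eval_pderiv_eq_zero_of_mem_ker_sq {σ : Type*} {R : Type*} [CommRing R] (c : σ → R) {g : MvPolynomial σ R}
    (hg : g ∈ (RingHom.ker (MvPolynomial.eval c)) ^ 2) (j : σ) : eval c (pderiv j g) = 0 := by
  rw [pow_two] at hg
  refine Submodule.mul_induction_on hg ?_ ?_
  · intro a ha b hb
    rw [RingHom.mem_ker] at ha hb
    rw [(pderiv j).leibniz, map_add, smul_eq_mul, smul_eq_mul, map_mul, map_mul, ha, hb, zero_mul, zero_mul, add_zero]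
  · intro x y hx hy
    rw [map_add, map_add, hx, hy, add_zero]

/-- **Jacobian ⟹ order one, in the local ring.**  If `G(y₀) = 0` and `∂_j G(y₀) ≠ 0`, then NO multiple `s * G` with `s(y₀) ≠ 0` lies in the square of the point
ideal `𝔫 = ker (eval y₀)` — i.e. `G ∉ 𝔫² k[y]_𝔫 = 𝔪²` in the local ring at `y₀`: `G` has `𝔪`-adic order exactly `1`, so it is a member of a regular system of parameters
(tree `exists_isRegularSystemOfParameters_of_adicOrder_eq_one`) and `k[y]_𝔫 ⧸ (G)` is regular (tree `IsRsopPart.isRegularLocalRing_quotient`, Matsumura 14.2).  Combined with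
`end_of_wonPlay` this is the whole hypersurface half of (O4); what (O4) still needs is the identification «local ring of the strict transform at the point = `k[y]_𝔫 ⧸ (toricStrict B g)`». -/
theorem mul_not_mem_ker_sq_of_eval_pderiv_ne_zero {n : ℕ} (y₀ : Fin n → k) (G s : MvPolynomial (Fin n) k) (hs : eval y₀ s ≠ 0)
    (hG0 : eval y₀ G = 0) {j : Fin n} (hj : eval y₀ (pderiv j G) ≠ 0) :
    s * G ∉ (RingHom.ker (MvPolynomial.eval y₀)) ^ 2 := by
  intro hmem
  have h := eval_pderiv_eq_zero_of_mem_ker_sq y₀ hmem j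
  rw [(pderiv j).leibniz, map_add, smul_eq_mul, smul_eq_mul, map_mul, map_mul, hG0, zero_mul, add_zero] at h
  exact mul_ne_zero hs hj h

/-- The same read through a reduction map `π : O → k` (the point `y₀` of the SPECIAL fibre of `𝔸ⁿ_O`): if the reduction `Ḡ = map π G` has `Ḡ(y₀) = 0`, `∂_j Ḡ(y₀) ≠ 0`,
then no `s * G` with `s̄(y₀) ≠ 0` lies in the square of the point ideal `ker (eval y₀ ∘ map π) ⊂ O[y]` (which contains `ker π`, e.g. `p`): `G` is a regular PARAMETER at the
closed point `y₀` of `𝔸ⁿ_O`, transversal to the special fibre. -/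
theorem mul_not_mem_ker_sq_of_eval_pderiv_map_ne_zero {n : ℕ} {O : Type} [CommRing O] (π : O →+* k) (y₀ : Fin n → k) (G s : MvPolynomial (Fin n) O)
    (hs : eval y₀ (map π s) ≠ 0) (hG0 : eval y₀ (map π G) = 0) {j : Fin n} (hj : eval y₀ (pderiv j (map π G)) ≠ 0) :
    s * G ∉ (RingHom.ker ((MvPolynomial.eval y₀).comp (MvPolynomial.map π))) ^ 2 := by
  intro hmem
  have hle : Ideal.map (MvPolynomial.map π) (RingHom.ker ((MvPolynomial.eval y₀).comp (MvPolynomial.map π))) ≤ RingHom.ker (MvPolynomial.eval y₀) := by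
    rw [Ideal.map_le_iff_le_comap, ← RingHom.comap_ker]
  have hmap : map π (s * G) ∈ (RingHom.ker (MvPolynomial.eval y₀)) ^ 2 := by
    have h1 := Ideal.mem_map_of_mem (MvPolynomial.map π) hmem
    rw [Ideal.map_pow] at h1
    exact Ideal.pow_right_mono hle 2 h1
  rw [map_mul] at hmap
  exact mul_not_mem_ker_sq_of_eval_pderiv_ne_zero y₀ (map π G) (map π s) hs hG0 hj hmap

/-- **(O4), hypersurface half, PACKAGED**: for a locally ND `g` and an E1-legal won play, in every final chart `B` and along every orbit over the origin, at every
point `y` of the strict transform `G = toricStrict B g` on that orbit, `G` has order ONE in the local ring at `y` (no `s * G`, `s(y) ≠ 0`, in `𝔫_y²`). -/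
theorem end_order_one_of_wonPlay {g : MvPolynomial (Fin n) k} (hND : IsLocallyNewtonNondegenerate g) {F' : Finset (Finset (Ray n))}
    (hR : Reach (table g) (orthantFan n) F') (hW : Won (table g) F') {σ : Finset (Ray n)} (hσ : σ ∈ F') :
    ∃ B : Fin n → Fin n → ℕ, σ = Finset.univ.image (fun i => rayOf (B i)) ∧ IsUnit (zMat B).det ∧
      ∀ I : Finset (Fin n), (∀ l, ∃ i ∈ I, 0 < B i l) →
        ∀ y : Fin n → k, (∀ i ∈ I, y i = 0) → (∀ j, j ∉ I → y j ≠ 0) → eval y (toricStrict B g) = 0 →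
          ∀ s : MvPolynomial (Fin n) k, eval y s ≠ 0 → s * toricStrict B g ∉ (RingHom.ker (MvPolynomial.eval y)) ^ 2 := by
  obtain ⟨B, hB, hdet, hend⟩ := end_of_wonPlay hND hR hW hσ
  refine ⟨B, hB, hdet, fun I hw y hy0 hy1 hGy s hs => ?_⟩
  obtain ⟨j, -, hj⟩ := hend I hw y hy0 hy1 hGy
  exact mul_not_mem_ker_sq_of_eval_pderiv_ne_zero y _ s hs hGy hj

/-! ### 12.8 One legal star IS one coordinate blow-up chart — the tree's `coordBlowupSubst` (Hu 2025 Prop. 5.3; PROVED)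

The star of `σ = cone(B)` at the face `τ_J = {rayOf (B j) : j ∈ J}`, read in the chart of the new cone that drops `t = rayOf (B i₀)` (`i₀ ∈ J`), has chart matrix
`starChart B J i₀` = `B` with row `i₀` replaced by `Σ_{j ∈ J} B j` (§12.5).  The induced map of chart coordinates `U_{B'} → U_B` is EXACTLY the standard chart map of
the blow-up of `𝔸ⁿ` along the coordinate subspace `V(y_j : j ∈ J)` over the generator `y_{i₀}`: `y_j ↦ y_{i₀}·y_j` (`j ∈ J ∖ {i₀}`), `y_i ↦ y_i` otherwise — the TREE's
`Literature.AlgebraicGeometry.Resolution.coordBlowupSubst k ↑J i₀` (`CoordinateBlowupChart.lean`, ANY base ring: `coordBlowupChartEquiv_coordBlowupSubst` says that under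
the chart isomorphism `k[y] ≃ k[y][I_J/y_{i₀}]` the structure map of the blow-up chart IS this substitution; scheme level over a field: `AffineCoordinateBlowupCharts.lean`,
`AffineCoordBlowup.chartImm_comp : chartImm ≫ π = Spec (coordBlowupSubst …)`, `iSup_chart`, `smooth_comp`).  Below: the substitution carries the total transform in chart
`B` to the total transform in chart `B'` (`coordBlowupSubst_chartPull`), and the strict transform to `y_{i₀}^{δ} ·` (strict transform in chart `B'`) with the EXPLICIT
exceptional multiplicity `δ = h(Σ_J B j) − Σ_J h(B j)` (`coordBlowupSubst_toricStrict`) — and `δ ≥ 1 ⟺ τ_J is Bad` (`bad_iff_sum_hminN_lt`): the centre lies on the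
strict transform (E1) iff the face is bad, with multiplicity `δ(τ)` (ROUND 5's `newRay_exponent`, now as a chart identity).  This is the polynomial content of (O2)/(O3). -/

/-- The chart matrix after the star at the face indexed by `J`, in the chart of the new cone dropping the ray of row `i₀`: row `i₀ ↦ Σ_{j ∈ J} B j`. -/
def starChart (B : Fin n → Fin n → ℕ) (J : Finset (Fin n)) (i₀ : Fin n) : Fin n → Fin n → ℕ :=
  Function.update B i₀ (fun l => ∑ j ∈ J, B j l)

/-- Row `i₀` of the star chart is the sum of the `J`-rows. [OURS · ND chart dictionary, res-L1-w45b-idea-1 g22] -/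
theorem starChart_self (B : Fin n → Fin n → ℕ) (J : Finset (Fin n)) (i₀ : Fin n) : starChart B J i₀ i₀ = fun l => ∑ j ∈ J, B j l := by
  unfold starChart; rw [Function.update_self]

/-- The other rows of the star chart are unchanged. [OURS · ND chart dictionary, res-L1-w45b-idea-1 g22] -/
theorem starChart_of_ne (B : Fin n → Fin n → ℕ) (J : Finset (Fin n)) {i₀ i : Fin n} (hi : i ≠ i₀) : starChart B J i₀ i = B i := by
  unfold starChart; rw [Function.update_of_ne hi]

/-- The `ℕ`-pairing is additive in the ray: pairing with a sum of rows is the sum of the pairings. [OURS · ND chart dictionary, res-L1-w45b-idea-1 g22] -/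
theorem pairN_sum (B : Fin n → Fin n → ℕ) (J : Finset (Fin n)) (m : Fin n → ℕ) :
    pairN (fun l => ∑ j ∈ J, B j l) m = ∑ j ∈ J, pairN (B j) m := by
  simp only [pairN, Finset.sum_mul]
  exact Finset.sum_comm

/-- Superadditivity of the order of vanishing: `Σ_J h(B j) ≤ h(Σ_J B j)`. -/
theorem sum_hminN_le (V : Finset (Fin n → ℕ)) (B : Fin n → Fin n → ℕ) (J : Finset (Fin n)) :
    ∑ j ∈ J, hminN V (B j) ≤ hminN V (fun l => ∑ j ∈ J, B j l) := by
  by_cases hV : V.Nonempty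
  · obtain ⟨m, hm, hmin⟩ := exists_pairN_eq_hminN hV (fun l => ∑ j ∈ J, B j l)
    rw [← hmin, pairN_sum]
    exact Finset.sum_le_sum fun j _ => hminN_le (B j) hm
  · have h0 : ∀ b : Fin n → ℕ, hminN V b = 0 := fun b => by unfold hminN; rw [dif_neg hV]
    simp only [h0, Finset.sum_const_zero, le_refl]

/-- **`δ(τ) ≥ 1 ⟺ τ is bad`**: the exceptional multiplicity of the strict transform along the centre of the star is positive iff the face is `Bad` (nonempty table). -/
theorem bad_iff_sum_hminN_lt {V : Finset (Fin n → ℕ)} (hV : V.Nonempty) (B : Fin n → Fin n → ℕ) (J : Finset (Fin n)) :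
    Bad V (J.image fun j => rayOf (B j)) ↔ ∑ j ∈ J, hminN V (B j) < hminN V (fun l => ∑ j ∈ J, B j l) := by
  classical
  constructor
  · intro hBad
    obtain ⟨m, hm, hmin⟩ := exists_pairN_eq_hminN hV (fun l => ∑ j ∈ J, B j l)
    rw [← hmin, pairN_sum]
    have hex : ∃ j ∈ J, hminN V (B j) < pairN (B j) m := by
      by_contra hcon
      simp only [not_exists, not_and, not_lt] at hcon
      apply hBad
      refine ⟨m, hm, ?_⟩
      intro ρ hρ m' hm'
      obtain ⟨j, hj, rfl⟩ := Finset.mem_image.1 hρ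
      rw [pair_rayOf, pair_rayOf, Nat.cast_le]
      exact (hcon j hj).trans (hminN_le (B j) hm')
    obtain ⟨j, hj, hlt⟩ := hex
    exact Finset.sum_lt_sum (fun i _ => hminN_le (B i) hm) ⟨j, hj, hlt⟩
  · intro hlt hgood
    obtain ⟨m, hm, hmin⟩ := hgood
    have heq : ∀ j ∈ J, pairN (B j) m = hminN V (B j) := by
      intro j hj
      refine le_antisymm ?_ (hminN_le (B j) hm)
      obtain ⟨m', hm', h'⟩ := exists_pairN_eq_hminN hV (B j)
      rw [← h']
      have := hmin (rayOf (B j)) (Finset.mem_image_of_mem _ hj) m' hm'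
      rwa [pair_rayOf, pair_rayOf, Nat.cast_le] at this
    have hle : hminN V (fun l => ∑ j ∈ J, B j l) ≤ ∑ j ∈ J, hminN V (B j) := by
      rw [← Finset.sum_congr rfl heq, ← pairN_sum]
      exact hminN_le _ hm
    omega

open Literature.AlgebraicGeometry.Resolution in
/-- The blow-up substitution on a monomial: `y^e ↦ y_{i₀}^{Σ_{j ∈ J ∖ i₀} e_j} · y^e`. -/
theorem coordBlowupSubst_monomial (J : Finset (Fin n)) (i₀ : Fin n) (e : Fin n → ℕ) (c : k) :
    coordBlowupSubst k (↑J : Set (Fin n)) i₀ (monomial (toFs e) c) = X i₀ ^ (∑ j ∈ J.erase i₀, e j) * monomial (toFs e) c := by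
  classical
  have hmon : (monomial (toFs e) c : MvPolynomial (Fin n) k) = C c * ∏ i, X i ^ e i := by
    rw [monomial_eq, Finsupp.prod_fintype _ _ (fun _ => pow_zero _)]; simp only [toFs_apply]
  have hX : ∀ i, coordBlowupSubst k (↑J : Set (Fin n)) i₀ (X i ^ e i) = (if i ∈ J ∧ i ≠ i₀ then X i₀ ^ e i else 1) * X i ^ e i := by
    intro i
    by_cases h : i ∈ J ∧ i ≠ i₀
    · rw [map_pow, coordBlowupSubst_X, if_pos ⟨Finset.mem_coe.2 h.1, h.2⟩, if_pos h, mul_pow]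
    · rw [map_pow, coordBlowupSubst_X, if_neg (fun h' => h ⟨Finset.mem_coe.1 h'.1, h'.2⟩), if_neg h, one_mul]
  have hfilt : Finset.univ.filter (fun i => i ∈ J ∧ i ≠ i₀) = J.erase i₀ := by
    ext i; simp only [Finset.mem_filter, Finset.mem_univ, true_and, Finset.mem_erase]; exact and_comm
  rw [hmon, map_mul, coordBlowupSubst_C, map_prod, Finset.prod_congr rfl (fun i _ => hX i), Finset.prod_mul_distrib, ← Finset.prod_filter,
    Finset.prod_pow_eq_pow_sum, hfilt]
  ring

/-- `y_{i₀}^a · (c y^e) = c y^{e + a δ_{i₀}}`. -/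
theorem X_pow_mul_monomial (i₀ : Fin n) (a : ℕ) (e : Fin n → ℕ) (c : k) :
    (X i₀ ^ a * monomial (toFs e) c : MvPolynomial (Fin n) k) = monomial (toFs (Function.update e i₀ (e i₀ + a))) c := by
  have hexp : Finsupp.single i₀ a + toFs e = toFs (Function.update e i₀ (e i₀ + a)) := by
    ext i
    rw [Finsupp.add_apply, toFs_apply, toFs_apply, Finsupp.single_apply]
    by_cases h : i₀ = i
    · subst h; rw [if_pos rfl, Function.update_self, add_comm]
    · rw [if_neg h, Function.update_of_ne (Ne.symm h), zero_add]
  rw [X_pow_eq_monomial, monomial_mul, one_mul, hexp]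

open Literature.AlgebraicGeometry.Resolution in
/-- **Total transforms match**: the blow-up substitution carries `g(y^B)` to `g(y^{B'})`, `B' = starChart B J i₀`. -/
theorem coordBlowupSubst_chartPull (B : Fin n → Fin n → ℕ) (g : MvPolynomial (Fin n) k) (J : Finset (Fin n)) {i₀ : Fin n} (hi₀ : i₀ ∈ J) :
    coordBlowupSubst k (↑J : Set (Fin n)) i₀ (chartPull B g) = chartPull (starChart B J i₀) g := by
  unfold chartPull
  rw [map_sum]
  refine Finset.sum_congr rfl fun d _ => ?_
  rw [coordBlowupSubst_monomial, X_pow_mul_monomial]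
  refine congrArg (fun v => monomial (toFs v) _) (funext fun i => ?_)
  by_cases h : i = i₀
  · subst h
    rw [Function.update_self, chartExp, chartExp, starChart_self, pairN_sum, ← Finset.add_sum_erase J _ hi₀]
    rfl
  · rw [Function.update_of_ne h, chartExp, chartExp, starChart_of_ne B J h]

open Literature.AlgebraicGeometry.Resolution in
/-- **Strict transforms match up to the exceptional factor `y_{i₀}^{δ(τ)}`**, `δ(τ) = h(Σ_J B j) − Σ_J h(B j)` (the multiplicity of the strict transform along the
centre `V(y_J)`): blowing up the centre and passing to the chart `y_{i₀}` turns the strict transform in chart `B` into `y_{i₀}^{δ} ·` (the strict transform in chart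
`starChart B J i₀`). -/
theorem coordBlowupSubst_toricStrict (B : Fin n → Fin n → ℕ) (g : MvPolynomial (Fin n) k) (J : Finset (Fin n)) {i₀ : Fin n} (hi₀ : i₀ ∈ J) :
    coordBlowupSubst k (↑J : Set (Fin n)) i₀ (toricStrict B g) =
      X i₀ ^ (hminN (table g) (fun l => ∑ j ∈ J, B j l) - ∑ j ∈ J, hminN (table g) (B j)) * toricStrict (starChart B J i₀) g := by
  unfold toricStrict
  rw [map_sum, Finset.mul_sum]
  refine Finset.sum_congr rfl fun d hd => ?_
  rw [coordBlowupSubst_monomial, X_pow_mul_monomial, X_pow_mul_monomial]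
  refine congrArg (fun v => monomial (toFs v) _) (funext fun i => ?_)
  by_cases h : i = i₀
  · subst h
    rw [Function.update_self, Function.update_self]
    have hmV := coe_mem_table hd
    have hsup := sum_hminN_le (table g) B J
    have hA := hminN_le (V := table g) (fun l => ∑ j ∈ J, B j l) hmV
    have hterm : ∀ j ∈ J, hminN (table g) (B j) ≤ pairN (B j) ⇑d := fun j _ => hminN_le (B j) hmV
    have hsplit : strictExp B (table g) (⇑d) i + ∑ j ∈ J.erase i, strictExp B (table g) (⇑d) j = ∑ j ∈ J, strictExp B (table g) (⇑d) j :=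
      Finset.add_sum_erase J _ hi₀
    have hdist : ∑ j ∈ J, strictExp B (table g) (⇑d) j = ∑ j ∈ J, pairN (B j) ⇑d - ∑ j ∈ J, hminN (table g) (B j) := by
      simp only [strictExp]
      exact Finset.sum_tsub_distrib J hterm
    rw [hsplit, hdist, strictExp, starChart_self, pairN_sum]
    rw [pairN_sum] at hA
    have hterm' : ∑ j ∈ J, hminN (table g) (B j) ≤ ∑ j ∈ J, pairN (B j) ⇑d := Finset.sum_le_sum hterm
    omega
  · rw [Function.update_of_ne h, Function.update_of_ne h, strictExp, strictExp, starChart_of_ne B J h]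

end Summit.ResolutionOfSingularities.ResolutionOfSingularities.Cruxes.EquisingularLiftNat.Sections.ND

end
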